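import Mathlib.Analysis.SpecialFunctions.Pow.Real
import Mathlib.Analysis.SpecialFunctions.Sqrt
import HarnessLib

/-!
# Route EIHFluxBalance — `InertialRecession` (E′), K1 / stub `stub_coerMomKernel` (Bk), far field, part F2c:
# every subluminal speed is `2s/(1+s²)` with `0 ≤ s < 1`

Helper file for the crux `stmt-FinalStateConjecture-17403`: the rational ("half-angle") parametrisation of speeds used by the
far-field row tables (`…SlavingFarFieldRows*`), `s = v/(1 + √(1−v²))`. No definitions, no `sorry`. [folklore]
-/

set_option linter.dupNamespace false

namespace Summit.FinalStateConjecture.FinalStateConjecture.Theorems.SublinearIsFree.Slaving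

/-- **Half-angle parametrisation of a subluminal speed**: for `0 ≤ v < 1` there is `s ∈ [0,1)` with `v = 2s/(1+s²)`
(namely `s = v/(1+√(1−v²))`); then `γ = (1+s²)/(1−s²)`. [folklore] -/
theorem exists_halfAngle_of_speed {v : ℝ} (hv0 : 0 ≤ v) (hv : v < 1) :
    ∃ s : ℝ, 0 ≤ s ∧ s < 1 ∧ v = 2 * s / (1 + s ^ 2) := by
  set w := Real.sqrt (1 - v ^ 2) with hw
  have hw0 : 0 < w := Real.sqrt_pos.2 (by nlinarith)
  have hw2 : w ^ 2 = 1 - v ^ 2 := by rw [hw, Real.sq_sqrt (by nlinarith)]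
  have hw1 : w ≤ 1 := by nlinarith
  refine ⟨v / (1 + w), by positivity, ?_, ?_⟩
  · rw [div_lt_one (by positivity)]; linarith
  · have h1 : (1 : ℝ) + w ≠ 0 := by positivity
    field_simp
    nlinarith [hw2]

/-- Registered carrier `slaving_farFieldSpeed_slaving12` of the crux item (= `exists_halfAngle_of_speed`). [folklore] -/
theorem slaving_farFieldSpeed_slaving12 : ∀ {v : ℝ}, 0 ≤ v → v < 1 → ∃ s : ℝ, 0 ≤ s ∧ s < 1 ∧ v = 2 * s / (1 + s ^ 2) :=
  exists_halfAngle_of_speed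

end Summit.FinalStateConjecture.FinalStateConjecture.Theorems.SublinearIsFree.Slaving
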